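import Summits.AtomisticToContinuum.HydrodynamicLimit.Theorems.CellForecastPressureDecay.Negative.LoneParticle
import Literature.Analysis.UnboundedOperators.LinearizedBoltzmannBurnettProofs

/-!
# `CellForecastPressureDecay`: the per-volume slack is load-bearing (the per-particle variant is false)

Negative knowledge for the crux `AntiMazurCoboundaries.CellForecastPressureDecay`
(stmt-AtomisticToContinuum-13915), from `Cruxes/CellForecastPressureDecay/Disproof.lean`
(seat refuter-cdisprove-stmt-AtomisticToContinuum-13915-0):

* § 5: a certified admissible observable `g_κ(v) = κ sin v₀ sin v₁`: continuous, `|g_κ| ≤ κ`,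
  `⊥ span(1, v, |v|²)` in `L²(stdGaussian)` (`gW_orthogonal`, by the coordinate reflections `v₀ ↦ -v₀`,
  `v₁ ↦ -v₁`), and `∫ e^{2g_κ} dγ > 1` for `κ ≠ 0` (`one_lt_integral_exp_gW`, strict Jensen).
* § 6: `CellForecastPressureDecayPerParticle` — the crux VERBATIM with the per-volume slack `e^{δ L³}`
  replaced by the per-particle slack `e^{δ n}` — is FALSE (`cellForecastPressureDecay_false_perParticle`:
  `n = 1`, `g = g_κ`, `c = 1`, `δ = ½ log ∫ e^{2g_κ} dγ`; the lone particle flies freely,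
  `Negative/LoneParticle.lean`). The volume normalisation is what makes lone / collisionless particles
  harmless; any proof of the crux must gain from collisions (the decay is an interaction effect).
-/

open MeasureTheory Set Metric Filter ProbabilityTheory
open scoped ENNReal InnerProductSpace
open Literature.Analysis.FluidPDE Literature.MathematicalPhysics.KineticTheory
open Literature.Analysis.UnboundedOperators (inner_basis_reflection_flip integral_stdGaussian_eq_zero_of_odd
  isOpenPosMeasure_stdGaussian integrable_one_add_norm_pow_stdGaussian)

namespace Summit.AtomisticToContinuum.HydrodynamicLimit.Theorems

noncomputable section

namespace CellForecastPressureDecay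
/-! ## § 5 A certified admissible observable: `g(v) = κ sin v₀ sin v₁` -/

/-- The witness observable `g_κ(v) = κ sin(v₀) sin(v₁)`. -/
def gW (κ : ℝ) (v : V3) : ℝ := κ * (Real.sin (v 0) * Real.sin (v 1))

/-- The witness observable is continuous. [folklore] -/
theorem continuous_gW (κ : ℝ) : Continuous (gW κ) := by
  unfold gW
  fun_prop

/-- `|sin v₀| |sin v₁| ≤ 1`. [folklore] -/
theorem abs_sin_mul_sin_le_one (v : V3) : |Real.sin (v 0)| * |Real.sin (v 1)| ≤ 1 := by
  have h := mul_le_mul (Real.abs_sin_le_one (v 0)) (Real.abs_sin_le_one (v 1)) (abs_nonneg _)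
    zero_le_one
  rwa [one_mul] at h

/-- `|g_κ| ≤ |κ|`. [folklore] -/
theorem abs_gW_le_abs (κ : ℝ) (v : V3) : |gW κ v| ≤ |κ| := by
  rw [gW, abs_mul, abs_mul]
  have h := mul_le_mul_of_nonneg_left (abs_sin_mul_sin_le_one v) (abs_nonneg κ)
  rwa [mul_one] at h

/-- `|g_κ| ≤ κ` for `κ ≥ 0`. [folklore] -/
theorem abs_gW_le {κ : ℝ} (hκ : 0 ≤ κ) (v : V3) : |gW κ v| ≤ κ := by
  have h := abs_gW_le_abs κ v
  rwa [abs_of_nonneg hκ] at h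

/-- The standard orthonormal basis of `V3`. -/
abbrev bV : OrthonormalBasis (Fin 3) ℝ V3 := EuclideanSpace.basisFun (Fin 3) ℝ

/-- Coordinates are inner products with the standard basis. [folklore] -/
theorem inner_bV (m : Fin 3) (v : V3) : ⟪bV m, v⟫_ℝ = v m := by
  simp [EuclideanSpace.basisFun_apply, EuclideanSpace.inner_single_left]

/-- Coordinates after the coordinate reflection `R_i` (reflection in `(e_i)ᗮ`). [folklore] -/
theorem reflect_apply (i m : Fin 3) (v : V3) :
    ((ℝ ∙ bV i)ᗮ.reflection v) m = if m = i then -v m else v m := by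
  rw [← inner_bV, inner_basis_reflection_flip bV i m v, inner_bV]

/-- `g_κ` is odd under `v₀ ↦ -v₀`. [folklore] -/
theorem gW_reflect0 (κ : ℝ) (v : V3) : gW κ ((ℝ ∙ bV 0)ᗮ.reflection v) = -gW κ v := by
  simp only [gW, reflect_apply, if_true, show (1 : Fin 3) ≠ 0 by decide, if_false, Real.sin_neg]
  ring

/-- `g_κ` is odd under `v₁ ↦ -v₁`. [folklore] -/
theorem gW_reflect1 (κ : ℝ) (v : V3) : gW κ ((ℝ ∙ bV 1)ᗮ.reflection v) = -gW κ v := by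
  simp only [gW, reflect_apply, if_true, show (0 : Fin 3) ≠ 1 by decide, if_false, Real.sin_neg]
  ring

/-- **Admissibility**: `g_κ ⊥ span(1, v, |v|²)` in `L²(stdGaussian)` (coordinate reflections:
`g_κ` is odd in `v₀` and odd in `v₁`). [folklore] -/
theorem gW_orthogonal (κ : ℝ) (c₀ c₂ : ℝ) (b : V3) :
    ∫ v, gW κ v * (c₀ + inner ℝ b v + c₂ * ‖v‖ ^ 2) ∂stdGaussian V3 = 0 := by
  -- expand ⟪b, v⟫ in coordinates
  have hinner : ∀ v : V3, inner ℝ b v = b 0 * v 0 + b 1 * v 1 + b 2 * v 2 := by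
    intro v
    rw [← bV.sum_inner_mul_inner b v, Fin.sum_univ_three]
    simp only [inner_bV]
    have : ∀ m, ⟪b, bV m⟫_ℝ = b m := fun m => by rw [real_inner_comm, inner_bV]
    simp only [this]
  set G₁ : V3 → ℝ := fun v => gW κ v * (c₀ + b 1 * v 1 + b 2 * v 2 + c₂ * ‖v‖ ^ 2) with hG₁
  set G₂ : V3 → ℝ := fun v => gW κ v * (b 0 * v 0) with hG₂
  have hsplit : (fun v => gW κ v * (c₀ + inner ℝ b v + c₂ * ‖v‖ ^ 2)) = fun v => G₁ v + G₂ v := by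
    funext v
    simp only [hG₁, hG₂, hinner]
    ring
  -- integrability (bounded × quadratic growth under the Gaussian)
  have hbound : ∀ (C : ℝ), 0 ≤ C → ∀ (H : V3 → ℝ), Continuous H →
      (∀ v, |H v| ≤ C * (1 + ‖v‖) ^ 2) → Integrable H (stdGaussian V3) := by
    intro C hC H hH hle
    refine Integrable.mono' ((integrable_one_add_norm_pow_stdGaussian 2).const_mul C)
      hH.aestronglyMeasurable (Eventually.of_forall fun v => ?_)
    rw [Real.norm_eq_abs]
    exact hle v
  have hκ' : ∀ v, |gW κ v| ≤ |κ| := abs_gW_le_abs κ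
  have hcoord : ∀ (v : V3) (m : Fin 3), |v m| ≤ ‖v‖ := fun v m => by
    simpa using PiLp.norm_apply_le v m
  have hI₁ : Integrable G₁ (stdGaussian V3) := by
    refine hbound (|κ| * (|c₀| + |b 1| + |b 2| + |c₂|)) (by positivity) G₁
      (by simp only [hG₁]; exact (continuous_gW κ).mul (by fun_prop)) fun v => ?_
    simp only [hG₁]
    rw [abs_mul]
    have h1 := hκ' v
    have h2 := hcoord v 1
    have h3 := hcoord v 2
    have hn := norm_nonneg v
    have : |c₀ + b 1 * v 1 + b 2 * v 2 + c₂ * ‖v‖ ^ 2| ≤ (|c₀| + |b 1| + |b 2| + |c₂|) * (1 + ‖v‖) ^ 2 := by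
      calc |c₀ + b 1 * v 1 + b 2 * v 2 + c₂ * ‖v‖ ^ 2|
          ≤ |c₀| + |b 1| * |v 1| + |b 2| * |v 2| + |c₂| * ‖v‖ ^ 2 := by
            have t1 := abs_add_le (c₀ + b 1 * v 1 + b 2 * v 2) (c₂ * ‖v‖ ^ 2)
            have t2 := abs_add_le (c₀ + b 1 * v 1) (b 2 * v 2)
            have t3 := abs_add_le c₀ (b 1 * v 1)
            have e1 : |b 1 * v 1| = |b 1| * |v 1| := abs_mul _ _
            have e2 : |b 2 * v 2| = |b 2| * |v 2| := abs_mul _ _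
            have e3 : |c₂ * ‖v‖ ^ 2| = |c₂| * ‖v‖ ^ 2 := by
              rw [abs_mul, abs_of_nonneg (by positivity : (0:ℝ) ≤ ‖v‖ ^ 2)]
            linarith
        _ ≤ (|c₀| + |b 1| + |b 2| + |c₂|) * (1 + ‖v‖) ^ 2 := by
            nlinarith [abs_nonneg c₀, abs_nonneg (b 1), abs_nonneg (b 2), abs_nonneg c₂,
              abs_nonneg (v 1), abs_nonneg (v 2)]
    calc |gW κ v| * |c₀ + b 1 * v 1 + b 2 * v 2 + c₂ * ‖v‖ ^ 2|
        ≤ |κ| * ((|c₀| + |b 1| + |b 2| + |c₂|) * (1 + ‖v‖) ^ 2) :=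
          mul_le_mul h1 this (abs_nonneg _) (abs_nonneg _)
      _ = |κ| * (|c₀| + |b 1| + |b 2| + |c₂|) * (1 + ‖v‖) ^ 2 := by ring
  have hI₂ : Integrable G₂ (stdGaussian V3) := by
    refine hbound (|κ| * |b 0|) (by positivity) G₂
      (by simp only [hG₂]; exact (continuous_gW κ).mul (by fun_prop)) fun v => ?_
    simp only [hG₂]
    rw [abs_mul, abs_mul]
    have h1 := hκ' v
    have h2 := hcoord v 0
    have hn := norm_nonneg v
    have hx : ‖v‖ ≤ (1 + ‖v‖) ^ 2 := by nlinarith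
    calc |gW κ v| * (|b 0| * |v 0|) ≤ |κ| * (|b 0| * ‖v‖) := by
          apply mul_le_mul h1 _ (by positivity) (abs_nonneg _)
          exact mul_le_mul_of_nonneg_left h2 (abs_nonneg _)
      _ = (|κ| * |b 0|) * ‖v‖ := by ring
      _ ≤ (|κ| * |b 0|) * (1 + ‖v‖) ^ 2 := mul_le_mul_of_nonneg_left hx (by positivity)
  -- the two odd integrals
  have h₁ : ∫ v, G₁ v ∂stdGaussian V3 = 0 := by
    refine integral_stdGaussian_eq_zero_of_odd (ℝ ∙ bV 0)ᗮ.reflection fun v => ?_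
    simp only [hG₁, gW_reflect0, reflect_apply, LinearIsometryEquiv.norm_map,
      show (1 : Fin 3) ≠ 0 by decide, show (2 : Fin 3) ≠ 0 by decide, if_false]
    ring
  have h₂ : ∫ v, G₂ v ∂stdGaussian V3 = 0 := by
    refine integral_stdGaussian_eq_zero_of_odd (ℝ ∙ bV 1)ᗮ.reflection fun v => ?_
    simp only [hG₂, gW_reflect1, reflect_apply, show (0 : Fin 3) ≠ 1 by decide, if_false]
    ring
  rw [hsplit, integral_add hI₁ hI₂, h₁, h₂, add_zero]

/-- **Strict Jensen for the witness**: `∫ e^{2 g_κ} dγ > 1` for `κ ≠ 0`. [folklore] -/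
theorem one_lt_integral_exp_gW {κ : ℝ} (hκ : κ ≠ 0) :
    1 < ∫ v, Real.exp (2 * gW κ v) ∂stdGaussian V3 := by
  haveI := isOpenPosMeasure_stdGaussian (E := V3)
  have hgc : Continuous (gW κ) := continuous_gW κ
  have hb : ∀ v, |gW κ v| ≤ |κ| := abs_gW_le_abs κ
  -- integrability of the pieces (bounded continuous on a probability space)
  have hIg : Integrable (gW κ) (stdGaussian V3) :=
    (integrable_const |κ|).mono' hgc.aestronglyMeasurable
      (Eventually.of_forall fun v => by rw [Real.norm_eq_abs]; exact hb v)
  have hIe : Integrable (fun v => Real.exp (2 * gW κ v)) (stdGaussian V3) := by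
    refine (integrable_const (Real.exp (2 * |κ|))).mono' (by fun_prop) (Eventually.of_forall fun v => ?_)
    rw [Real.norm_eq_abs, abs_of_pos (Real.exp_pos _), Real.exp_le_exp]
    have := hb v
    rw [abs_le] at this
    linarith [this.2]
  set D : V3 → ℝ := fun v => Real.exp (2 * gW κ v) - (1 + 2 * gW κ v) with hD
  have hD0 : ∀ v, 0 ≤ D v := fun v => by
    simp only [hD]
    linarith [Real.add_one_le_exp (2 * gW κ v)]
  have hI2 : Integrable (fun v => 2 * gW κ v) (stdGaussian V3) := hIg.const_mul 2
  have hI12 : Integrable (fun v => 1 + 2 * gW κ v) (stdGaussian V3) := (integrable_const 1).add hI2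
  have hID : Integrable D (stdGaussian V3) := hIe.sub hI12
  -- D > 0 at the point v* = (π/2, π/2, 0)
  set vstar : V3 := WithLp.toLp 2 ![Real.pi / 2, Real.pi / 2, 0] with hvstar
  have hgstar : gW κ vstar = κ := by
    simp [gW, hvstar, Real.sin_pi_div_two]
  have hDstar : 0 < D vstar := by
    simp only [hD, hgstar]
    have := Real.add_one_lt_exp (by positivity : 2 * κ ≠ 0)
    linarith
  have hDpos : 0 < ∫ v, D v ∂stdGaussian V3 := by
    rw [integral_pos_iff_support_of_nonneg hD0 hID]
    have hopen : IsOpen (Function.support D) := by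
      simp only [hD]
      exact isOpen_ne_fun (by fun_prop) continuous_const
    exact hopen.measure_pos _ ⟨vstar, hDstar.ne'⟩
  have hmean : ∫ v, gW κ v ∂stdGaussian V3 = 0 :=
    integral_stdGaussian_eq_zero_of_odd (ℝ ∙ bV 0)ᗮ.reflection (gW_reflect0 κ)
  have hsplit : ∫ v, Real.exp (2 * gW κ v) ∂stdGaussian V3 =
      (∫ v, D v ∂stdGaussian V3) + ∫ v, (1 + 2 * gW κ v) ∂stdGaussian V3 := by
    rw [← integral_add hID hI12]
    refine integral_congr_ae (Eventually.of_forall fun v => ?_)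
    simp only [hD]
    ring
  have h12 : ∫ v, (1 + 2 * gW κ v) ∂stdGaussian V3 = 1 := by
    rw [integral_add (integrable_const (1 : ℝ)) hI2, integral_const_mul, hmean, integral_const,
      smul_eq_mul, mul_one, probReal_univ]
    ring
  rw [hsplit, h12]
  linarith

/-! ## § 6 The per-volume slack is load-bearing: the per-particle variant is false (n = 1) -/

/-- `CellForecastPressureDecay` with the PER-VOLUME slack `e^{δ L³}` replaced by the per-particle
slack `e^{δ n}` (everything else verbatim). -/
def CellForecastPressureDecayPerParticle : Prop :=
  ∃ σ₀ : ℝ, 0 < σ₀ ∧ ∀ σ : ℝ, 0 < σ → σ < σ₀ → ∃ κ : ℝ, 0 < κ ∧ ∀ g : Literature.MathematicalPhysics.KineticTheory.V3 → ℝ, Continuous g → (∀ v, |g v| ≤ κ) → (∀ (c₀ c₂ : ℝ) (b : Literature.MathematicalPhysics.KineticTheory.V3), ∫ v, g v * (c₀ + inner ℝ b v + c₂ * ‖v‖ ^ 2) ∂(ProbabilityTheory.stdGaussian Literature.MathematicalPhysics.KineticTheory.V3) = 0) → ∀ δ : ℝ, 0 < δ → ∃ T : ℝ, 0 < T ∧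 ∃ R₀ : ℝ, 0 < R₀ ∧ ∀ R : ℝ, R₀ ≤ R → ∃ L₀ : ℝ, 0 < L₀ ∧ ∀ L : ℝ, L₀ ≤ L → ∀ n : ℕ, (n : ℝ) ≤ 2 * L ^ 3 → ∀ (Ψ : (k : ℕ) → Literature.Analysis.FluidPDE.HardSphereFlow (Literature.Analysis.FluidPDE.Euclidean.geometry (Fin 3)) σ k) (c : ℝ), |c| ≤ 1 → ∫⁻ z, ENNReal.ofReal (Real.exp (2 * c * ∑ i : Fin n, T⁻¹ * ∫ t in (0 : ℝ)..T, g (Literature.Analysis.FluidPDE.localClusterState Ψ R t z i).2)) ∂(Literature.Analysis.FluidPDE.particleLaw (Ψ n) (Literature.Analysis.FluidPDE.canonicalDensity (Literature.Analysis.FluidPDE.Euclidean.geometry (Fin 3)) σ n (fun p => Set.indicator {x : Literature.MathematicalPhysics.KineticTheory.V3 | ∀ k, x k ∈ Set.Icc (0 : ℝ) L} (fun _ => (1 : ℝ)) p.1 * Literature.Analysis.FluidPDE.globalMaxwellian p.2))) ≤ ENNReal.ofReal (Real.exp (δ * n))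

/-- **The per-volume slack is load-bearing**: with `e^{δ n}` in place of `e^{δ L³}` the statement
is false. Witness: `g = κ sin v₀ sin v₁` (admissible), `n = 1` (a lone particle flies freely, so
its window average is `g(v)` for every horizon `T`), `c = 1`, `δ = ½ log ∫ e^{2g} dγ > 0`:
the left side is `∫ e^{2g} dγ > e^{δ}`. [folklore] -/
theorem cellForecastPressureDecay_false_perParticle : ¬ CellForecastPressureDecayPerParticle := by
  rintro ⟨σ₀, hσ₀, h⟩
  set σ : ℝ := σ₀ / 2 with hσdef
  have hσpos : 0 < σ := by positivity
  obtain ⟨κ, hκ, h⟩ := h σ hσpos (by linarith)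
  set J : ℝ := ∫ v, Real.exp (2 * gW κ v) ∂stdGaussian V3 with hJ
  have hJ1 : 1 < J := one_lt_integral_exp_gW hκ.ne'
  have hδ : 0 < Real.log J / 2 := by positivity [Real.log_pos hJ1]
  obtain ⟨T, hT, R₀, hR₀, h⟩ := h (gW κ) (continuous_gW κ) (abs_gW_le hκ.le) (gW_orthogonal κ)
    (Real.log J / 2) hδ
  obtain ⟨L₀, hL₀, h⟩ := h R₀ le_rfl
  set L : ℝ := max L₀ 1 with hLdef
  have hL1 : 1 ≤ L := le_max_right _ _
  set Ψ : (k : ℕ) → HardSphereFlow (Euclidean.geometry (Fin 3)) σ k :=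
    fun k => (HardSphereFlow.nonempty_holds hσpos k).some with hΨ
  have hL3 : (1 : ℝ) ≤ L ^ 3 := one_le_pow₀ hL1
  have key := h L (le_max_left _ _) 1 (by norm_num; linarith) Ψ 1 (by simp)
  simp_rw [windowAverage_one Ψ R₀ hT.ne' (gW κ) 1] at key
  have hFc : Continuous fun v : V3 => Real.exp (2 * 1 * gW κ v) :=
    (continuous_const.mul (continuous_gW κ)).rexp
  rw [← cellRef_eq, lintegral_cellLaw_one σ (by linarith) (Ψ 1) (F := fun v => Real.exp (2 * 1 * gW κ v))
      hFc.measurable (fun v => (Real.exp_pos _).le) ?_] at key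
  · rw [← integral_stdGaussian_eq_integral_mul_globalMaxwellian,
      ENNReal.ofReal_le_ofReal_iff (by positivity)] at key
    simp only [mul_one, Nat.cast_one] at key
    -- key : J ≤ exp (log J / 2)
    have hJpos : 0 < J := by linarith
    have hs : Real.exp (Real.log J / 2) = Real.sqrt J := by
      rw [Real.exp_half, Real.exp_log hJpos]
    have hs1 : 1 < Real.sqrt J := by
      rw [Real.lt_sqrt zero_le_one]
      simpa using hJ1
    have hss : Real.sqrt J * Real.sqrt J = J := Real.mul_self_sqrt hJpos.le
    rw [hs] at key
    nlinarith
  · -- integrability of M · e^{2g}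
    refine integrable_globalMaxwellian.mul_bdd (c := Real.exp (2 * κ)) hFc.aestronglyMeasurable
      (Eventually.of_forall fun v => ?_)
    rw [Real.norm_eq_abs, abs_of_pos (Real.exp_pos _)]
    refine Real.exp_le_exp.2 (?_ : 2 * 1 * gW κ v ≤ 2 * κ)
    have := abs_gW_le hκ.le v
    rw [abs_le] at this
    linarith [this.2]

end CellForecastPressureDecay

end

end Summit.AtomisticToContinuum.HydrodynamicLimit.Theorems
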